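import Mathlib
import HarnessLib
import HarnessLib.Audit
import Summits.ValiantsHypothesis.ValiantsHypothesis.Theorems.LacunarySymmetroidMatrixDescartesCensusLaguerreSum
import Summits.ValiantsHypothesis.ValiantsHypothesis.Theorems.LacunarySymmetroidMatrixDescartesZeroChangeValleyDipBudget

/-!
# ValiantsHypothesis / LacunarySymmetroid — crux `MatrixDescartes` (stmt-ValiantsHypothesis-18050, V1), LINE (A) «product_plus_one»,
# research stubs `stub_classRowK3` / `stub_eulerBoundK3`, valley residue: TWO WEAK-VALLEY ROWS HAVE AT MOST THREE CRITICAL POINTS (`m = 2` of V)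

Seventh panel of the valley-residue series.  The located linear law V (✓ `…ZeroChangeValleyDipBudget` header: `posCrit ≤ 2m − 1`, `#DIPS ≤ m` for
zero-free valley companies) holds for `m = 2` by Descartes, for EVERY support ratio and with WEAK signs: for two rows of sign type `(+,−,+)` with
zeros allowed (`p_i ≥ 0`, `q_i ≤ 0`, `s_i ≥ 0`; so binomials `p + sX^c`, pure valleys, and rows WITH positive zeros are all included) the
five-nomial `X·(g₁g₂)′` (✓ `ZeroChange.X_mul_derivative_WKK`, support `{a, 2a, c, a+c, 2c}`) has the sign pattern `− | + + | − | +` along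
increasing exponents WHATEVER the position of `2a` relative to `c` (the two nonnegative coefficients sit at `2a` and `c`, both in `[a+1, a+c)`), hence
at most three sign variations (✓ `Census.signVariations_succ_le_of_blocks` with the four blocks `[0,a] | [a+1,a+c) | {a+c} | (a+c, 2c]`):

* `signVariations_le_three_of_valleyPattern` — the block count for the pattern `(w_a ≤ 0, w_{2a} ≥ 0, w_c ≥ 0, w_{a+c} ≤ 0, w_{2c} ≥ 0)`;
* ★ `posCrit_two_weakValleys_le_three` — `posCrit (g₁·g₂) ≤ 3 = 2·2 − 1`;
* `posCrit_two_weakValleys_le_three'` (company form over `Fin 2`) and `euler_bottom_two_weakValleys_le_three` (Euler currency, every support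
  `d₀ < d₁ < d₂`): `Z₊(eulerNumerator d a 0) ≤ 3` for `m = 2` rows with `a_{j0} ≥ 0 ≥ a_{j1}`, `a_{j2} ≥ 0`.
The companion ✓ `ZeroChange.twoRowWKK` is the `(−,+,+) × (+,+,+)` pattern; this file is the `(+,−,+) × (+,−,+)` pattern (Descartes-sharp: two
scale-separated deep valleys have exactly `min, max, min`).

HONEST FRAMING: helper theorem (the base case of a located law), def-free, no named facts, no `sorry`, standard axioms; closes NO stub by name;
`OneChangeFloorK3`, `EulerBoundK3`, `ClassRowK3Linear`, `PPOPolyLaw`, `MatrixDescartes` (stmt-ValiantsHypothesis-18050) stay OPEN; `VP ≠ VNP` is NOT proved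
and nothing here bears on it.  [folklore] Descartes' rule of signs; no citation needed.
-/

set_option linter.dupNamespace false

namespace Summit.ValiantsHypothesis.ValiantsHypothesis.Theorems.LacunarySymmetroidMatrixDescartes

namespace ZeroChange

open Polynomial Finset
open Summit.ValiantsHypothesis.ValiantsHypothesis.Theorems.LacunarySymmetroidMatrixDescartes.Census (signVariations_succ_le_of_blocks)

/-- **Four sign blocks `− | + + | − | +` on the support `{a, 2a, c, a+c, 2c}` ⇒ at most three sign variations** (`0 < a < c`; the
relative order of `2a` and `c` is irrelevant, and `2a = c` is allowed). [folklore] -/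
theorem signVariations_le_three_of_valleyPattern (Q : ℝ[X]) (a c : ℕ) (ha : 0 < a) (hac : a < c) (w₁ w₂ w₃ w₄ w₅ : ℝ)
    (hcoeff : ∀ m, Q.coeff m = (if m = a then w₁ else 0) + (if m = 2 * a then w₂ else 0) + (if m = c then w₃ else 0)
      + (if m = a + c then w₄ else 0) + (if m = 2 * c then w₅ else 0))
    (hw₁ : w₁ ≤ 0) (hw₂ : 0 ≤ w₂) (hw₃ : 0 ≤ w₃) (hw₄ : w₄ ≤ 0) (hw₅ : 0 ≤ w₅) (hdeg : Q.natDegree < 2 * c + 1) :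
    Q.signVariations ≤ 3 := by
  have key := signVariations_succ_le_of_blocks 4 Q
    (fun k => if k < 1 then 0 else if k < 2 then a + 1 else if k < 3 then a + c else if k < 4 then a + c + 1 else 2 * c + 1)
    (if_pos (by norm_num)) ?_ ?_ ?_
  · omega
  · refine monotone_nat_of_le_succ fun k => ?_
    rcases Nat.lt_or_ge k 4 with hk | hk
    · interval_cases k
      · simp
      · simp; omega
      · simp
      · simp; omega
    · simp only [if_neg (show ¬ k < 1 by omega), if_neg (show ¬ k < 2 by omega), if_neg (show ¬ k < 3 by omega),
        if_neg (show ¬ k < 4 by omega), if_neg (show ¬ k + 1 < 1 by omega), if_neg (show ¬ k + 1 < 2 by omega),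
        if_neg (show ¬ k + 1 < 3 by omega), if_neg (show ¬ k + 1 < 4 by omega)]
      exact le_rfl
  · simp only [show ¬ (4 : ℕ) < 1 by norm_num, show ¬ (4 : ℕ) < 2 by norm_num, show ¬ (4 : ℕ) < 3 by norm_num,
      lt_irrefl, if_false]
    exact hdeg
  · intro i hi
    interval_cases i
    · refine ⟨-1, Or.inr rfl, fun m _ hm2 => ?_⟩
      simp only [show (0 : ℕ) + 1 < 2 by norm_num, show ¬ (0 : ℕ) + 1 < 1 by norm_num, if_true, if_false] at hm2
      rw [hcoeff m, if_neg (show m ≠ 2 * a by omega), if_neg (show m ≠ c by omega), if_neg (show m ≠ a + c by omega),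
        if_neg (show m ≠ 2 * c by omega)]
      split_ifs <;> nlinarith
    · refine ⟨1, Or.inl rfl, fun m hm1 hm2 => ?_⟩
      simp only [show (1 : ℕ) < 2 by norm_num, show ¬ (1 : ℕ) < 1 by norm_num, if_true, if_false] at hm1
      simp only [show ¬ (1 : ℕ) + 1 < 2 by norm_num, show ¬ (1 : ℕ) + 1 < 1 by norm_num, show (1:ℕ) + 1 < 3 by norm_num,
        if_true, if_false] at hm2
      rw [hcoeff m, if_neg (show m ≠ a by omega), if_neg (show m ≠ a + c by omega), if_neg (show m ≠ 2 * c by omega)]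
      split_ifs <;> nlinarith
    · refine ⟨-1, Or.inr rfl, fun m hm1 hm2 => ?_⟩
      simp only [show ¬ (2 : ℕ) < 2 by norm_num, show ¬ (2 : ℕ) < 1 by norm_num, show (2:ℕ) < 3 by norm_num,
        if_true, if_false] at hm1
      simp only [show ¬ (2 : ℕ) + 1 < 2 by norm_num, show ¬ (2 : ℕ) + 1 < 1 by norm_num, show ¬ (2:ℕ) + 1 < 3 by norm_num,
        show (2:ℕ) + 1 < 4 by norm_num, if_true, if_false] at hm2
      rw [hcoeff m, if_neg (show m ≠ a by omega), if_neg (show m ≠ 2 * a by omega), if_neg (show m ≠ c by omega),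
        if_neg (show m ≠ 2 * c by omega)]
      split_ifs <;> nlinarith
    · refine ⟨1, Or.inl rfl, fun m hm1 _ => ?_⟩
      simp only [show ¬ (3 : ℕ) < 2 by norm_num, show ¬ (3 : ℕ) < 1 by norm_num, show ¬ (3:ℕ) < 3 by norm_num,
        show (3:ℕ) < 4 by norm_num, if_true, if_false] at hm1
      rw [hcoeff m, if_neg (show m ≠ a by omega), if_neg (show m ≠ 2 * a by omega), if_neg (show m ≠ c by omega),
        if_neg (show m ≠ a + c by omega)]
      split_ifs <;> nlinarith

/-- ★ **TWO WEAK-VALLEY ROWS: at most three positive critical points** (`0 < a < c`, `p_i ≥ 0`, `q_i ≤ 0`, `s_i ≥ 0`; zeros of the rows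
allowed) — the case `m = 2` of the located law `posCrit ≤ 2m − 1`, for every support ratio. [folklore] -/
theorem posCrit_two_weakValleys_le_three (a c : ℕ) (ha : 0 < a) (hac : a < c) (p₁ q₁ s₁ p₂ q₂ s₂ : ℝ)
    (hp₁ : 0 ≤ p₁) (hq₁ : q₁ ≤ 0) (hs₁ : 0 ≤ s₁) (hp₂ : 0 ≤ p₂) (hq₂ : q₂ ≤ 0) (hs₂ : 0 ≤ s₂) :
    posCrit (row a c p₁ q₁ s₁ * row a c p₂ q₂ s₂) ≤ 3 := by
  have hc : 0 < c := ha.trans hac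
  refine (posCrit_le_signVariations _).trans ?_
  have hrow : row a c p₁ q₁ s₁ = row a c (-(-p₁)) q₁ s₁ := by rw [neg_neg]
  rw [hrow, X_mul_derivative_WKK a c ha hc (-p₁) q₁ s₁ p₂ q₂ s₂]
  refine signVariations_le_three_of_valleyPattern _ a c ha hac ((a : ℝ) * (q₁ * p₂ - (-p₁) * q₂)) (2 * (a : ℝ) * (q₁ * q₂))
    ((c : ℝ) * (s₁ * p₂ - (-p₁) * s₂)) (((a : ℝ) + c) * (q₁ * s₂ + s₁ * q₂)) (2 * (c : ℝ) * (s₁ * s₂)) (fun m => ?_) ?_ ?_ ?_ ?_ ?_ ?_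
  · simp only [coeff_add, coeff_C_mul_X_pow]
  · have ha' : (0 : ℝ) ≤ a := Nat.cast_nonneg a
    have h1 : q₁ * p₂ - (-p₁) * q₂ ≤ 0 := by nlinarith [mul_nonpos_of_nonpos_of_nonneg hq₁ hp₂, mul_nonneg_of_nonpos_of_nonpos hq₂ (neg_nonpos.2 hp₁)]
    exact mul_nonpos_of_nonneg_of_nonpos ha' h1
  · have ha' : (0 : ℝ) ≤ a := Nat.cast_nonneg a
    have : 0 ≤ q₁ * q₂ := mul_nonneg_of_nonpos_of_nonpos hq₁ hq₂
    positivity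
  · have hc' : (0 : ℝ) ≤ c := Nat.cast_nonneg c
    have h1 : 0 ≤ s₁ * p₂ - (-p₁) * s₂ := by nlinarith [mul_nonneg hs₁ hp₂, mul_nonneg hp₁ hs₂]
    exact mul_nonneg hc' h1
  · have hac' : (0 : ℝ) ≤ (a : ℝ) + c := by positivity
    have h1 : q₁ * s₂ + s₁ * q₂ ≤ 0 := by nlinarith [mul_nonpos_of_nonpos_of_nonneg hq₁ hs₂, mul_nonpos_of_nonneg_of_nonpos hs₁ hq₂]
    exact mul_nonpos_of_nonneg_of_nonpos hac' h1
  · have : 0 ≤ s₁ * s₂ := mul_nonneg hs₁ hs₂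
    positivity
  · -- degree below `2c + 1`
    have hle : (C ((a : ℝ) * (q₁ * p₂ - (-p₁) * q₂)) * X ^ a + C (2 * (a : ℝ) * (q₁ * q₂)) * X ^ (2 * a) +
        C ((c : ℝ) * (s₁ * p₂ - (-p₁) * s₂)) * X ^ c + C (((a : ℝ) + c) * (q₁ * s₂ + s₁ * q₂)) * X ^ (a + c) +
        C (2 * (c : ℝ) * (s₁ * s₂)) * X ^ (2 * c)).natDegree ≤ 2 * c := by
      rw [natDegree_le_iff_coeff_eq_zero]
      intro N hN
      simp only [coeff_add, coeff_C_mul_X_pow, if_neg (show N ≠ a by omega), if_neg (show N ≠ 2 * a by omega),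
        if_neg (show N ≠ c by omega), if_neg (show N ≠ a + c by omega), if_neg (show N ≠ 2 * c by omega), add_zero]
    omega

/-- Company form over `Fin 2`. [folklore] -/
theorem posCrit_two_weakValleys_le_three' (a c : ℕ) (ha : 0 < a) (hac : a < c) (co : Fin 2 → ℝ × ℝ × ℝ)
    (hp : ∀ j, 0 ≤ (co j).1) (hq : ∀ j, (co j).2.1 ≤ 0) (hs : ∀ j, 0 ≤ (co j).2.2) :
    posCrit (∏ j, row a c (co j).1 (co j).2.1 (co j).2.2) ≤ 3 := by
  rw [Fin.prod_univ_two]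
  exact posCrit_two_weakValleys_le_three a c ha hac _ _ _ _ _ _ (hp 0) (hq 0) (hs 0) (hp 1) (hq 1) (hs 1)

/-- ★ **EULER CURRENCY, `m = 2`**: on every support `d₀ < d₁ < d₂`, two rows with `a_{j0} ≥ 0 ≥ a_{j1}`, `a_{j2} ≥ 0` have
`Z₊(eulerNumerator d a 0) ≤ 3`. [folklore] -/
theorem euler_bottom_two_weakValleys_le_three (d : Fin 3 → ℕ) (h01 : d 0 < d 1) (h12 : d 1 < d 2) (a : Fin 2 → Fin 3 → ℝ)
    (hp : ∀ j, 0 ≤ a j 0) (hq : ∀ j, a j 1 ≤ 0) (hs : ∀ j, 0 ≤ a j 2) :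
    ((∑ j, (∑ l, C (a j l * ((d l : ℝ) - d 0)) * X ^ (d l)) * ∏ i ∈ Finset.univ.erase j, (∑ l, C (a i l) * X ^ (d l))
        : ℝ[X]).roots.toFinset.filter (fun t => 0 < t)).card ≤ 3 := by
  rw [card_posRoots_euler_bottom_eq_posCrit d h01.le (h01.le.trans h12.le) a]
  exact posCrit_two_weakValleys_le_three' (d 1 - d 0) (d 2 - d 0) (by omega) (by omega) (fun j => (a j 0, a j 1, a j 2)) hp hq hs

end ZeroChange

end Summit.ValiantsHypothesis.ValiantsHypothesis.Theorems.LacunarySymmetroidMatrixDescartes
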